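import Summits.CriticalPhenomena.PercolationContinuityZ3.Theorems.PercNearOneGluingNoHeavyQuantLightResidDECLaw
import Summits.CriticalPhenomena.PercolationContinuityZ3.Theorems.PercNearOneGluingNoHeavyQuantGluedForestSDEC
import HarnessLib

/-!
# QUANT lane R8, T-DEC: THE PURE FORM FAILS WITH TREE-OK GLUED COMPANIONS — the glued sibling `R¹[9/10](R¹⁶[½])` recorded at ANY sub-floor
# above its tree floor `½` (here `10/19 ≤ mean/M = 9/17`) beside two tree-OK `R¹[19/20](R¹[½])` breaks the far row of the residual at the dominant
# layer `5` (census-1 gen 24, FINDING 2, witness 3)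

builds on p205010 (kernel theorem, internal audit signed; external expert review pending)

Support file (`--supports stmt-CriticalPhenomena-4575`), QUANT lane seat prim-quant-census-1 (gen 24); memo
`run/shared/lean/prim/quant/prim-quant-census-1/RESID-DEC-G24.md` §11.  Theorems only, standard axioms, no sorries.  Sequel of
`…QuantLightResidDECLawRefutation` (witnesses 1–2: unit / relay companions); this file closes the "composite companions" loophole: the family of
lists of `≥ 3` aff-OK siblings whose laws are NOT point masses (the law-level clauses of `Sib.TreeOK`) still carries no light residual DEC.

THE WITNESS.  `C = gluedSib 1 1 (19/20) (1/2) (½·360/361)` = `R¹[19/20](R¹[½])`, tree-OK at the floor `x = 9/19` (`witness3_companion_treeOK`);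
`S = gluedSib 1 16 (9/10) (1/2) (10/19)` = `R¹[9/10](R¹⁶[½])` with its sub-floor RECORDED at `10/19`: law-OK, not a point mass, tree-built at every
floor `< ½` (`gluedSib_treeBuiltN`), top-affordable at `10/19` (`10/19 · 17 = 170/19 ≤ 9 = mean`) — so aff-OK at `x = 9/10 · 10/19 = 9/19` — but NOT
tree-OK there (its tree floor is `½ < 10/19`).  `L = [C, C, S]`, `a = 19/20`: `ftop L = 21`, `fmean L = 219/20`, residual mean `T = 4161/400 > 10`, so
layer `5` is dominant; without the `16`-blob the forest reaches at most `1 + 2 + 2 = 5`, so the residual's mass above `5` is the blob mass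
`a·q/2 = 171/400` (at ANY weight), while the floor is `min (a x) (1/2) = 9/20 = 180/400`: the far row `tail_ge_of_decAt` fails.  The threshold is EXACT:
`a·x > a·q/2 ⟺ x₁ > ½` = the tree floor; census-1's exact LP finds `[C, C, S]` IN at every layer and gate for `x₁ ≤ ½` and OUT at layers `5–18` for
every `x₁ ∈ (½, 9/17]` at `a ∈ {.95, .99}` (`code/pure4.py`).

* `head_flaw_glued_CCS` (the forest law's mass below `6` is `1 − q/2`, symbolic in the gates), `witness3_companion_treeOK`, `witness3_law_treeBuiltN`;
* **`not_lightResidDECOn_affOK_composite : ¬ LightResidDECOn (fun x L => (∀ s ∈ L, s.AffOK x ∧ ∀ K, s.ρ ≠ δ_K) ∧ 3 ≤ L.length)`**.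

HONEST STATUS: refutes the oracle-free pure form on composite aff-OK lists; `LightResidDEC`, `ResidDEC`, `SiblingStep`, `GateStepN`, `FarTreeRow`
(tree floors) OPEN and untouched; RATE class log\* / honest sentence of `run/shared/lean/prim/quant/README.md` unchanged.  [this work]; glued
siblings: prim-quant-arm-1 g49; the conjecture's family: prim-quant-arm-1 g50.  Nothing here is cited as a published result.  The gluing rows served
[cite: KozmaNitzan2024, Conjecture 3 (p. 15)]; product measure [cite: Grimmett1999, §1.3 p. 10].
-/

noncomputable section

open scoped BigOperators

namespace Summit.CriticalPhenomena.PercolationContinuityZ3.Theorems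
namespace Quant

open Finset

namespace LawDec

/-- the point mass `δ_K` -/
local notation3 "δ[" K "]" => (fun k : ℕ => if k = (K : ℕ) then (1 : ℝ) else 0)

/-! ### The forest law of `[C, C, S]` below the blob -/

/-- **the mass of the forest law of `[R¹[q_c](R¹[½]), R¹[q_c](R¹[½]), R¹[q](R¹⁶[½])]` below `6` is `1 − q/2`** (the `16`-blob fires with probability
`q/2`; without it the count is at most `1 + 2 + 2 = 5`); symbolic in the root gates, any recorded sub-floors. [this work] -/
theorem head_flaw_glued_CCS (q qc x₁ x₁' : ℝ) :
    ∑ h ∈ Finset.range 6, flaw [gluedSib 1 1 qc (1 / 2) x₁', gluedSib 1 1 qc (1 / 2) x₁', gluedSib 1 16 q (1 / 2) x₁] h = 1 - q / 2 := by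
  have vS : ∀ h, gate (slice δ[1] 16 (1 / 2)) q h =
      q * ((if h = 1 then 1 - 1 / 2 else 0) + (if h = 1 + 16 then (1 / 2 : ℝ) else 0)) + (1 - q) * (if h = 0 then (1 : ℝ) else 0) := fun h => by
    rw [gate_apply, gluedSib_rho_apply 1 16 le_rfl (by norm_num)]
  have vC : ∀ h, gate (slice δ[1] 1 (1 / 2)) qc h =
      qc * ((if h = 1 then 1 - 1 / 2 else 0) + (if h = 1 + 1 then (1 / 2 : ℝ) else 0)) + (1 - qc) * (if h = 0 then (1 : ℝ) else 0) := fun h => by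
    rw [gate_apply, gluedSib_rho_apply 1 1 le_rfl le_rfl]
  have e1 : lconv 0 17 δ[0] (gate (slice δ[1] 16 (1 / 2)) q) = gate (slice δ[1] 16 (1 / 2)) q := by
    funext k
    refine lconv_delta_left 0 17 _ (fun i hi => ?_) k
    rw [vS i, if_neg (by omega), if_neg (by omega), if_neg (by omega)]
    ring
  show ∑ h ∈ Finset.range 6, lconv 19 2 (lconv 17 2 (lconv 0 17 δ[0] (gate (slice δ[1] 16 (1 / 2)) q)) (gate (slice δ[1] 1 (1 / 2)) qc))
      (gate (slice δ[1] 1 (1 / 2)) qc) h = 1 - q / 2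
  rw [e1]
  simp only [Finset.sum_range_succ, Finset.sum_range_zero, lconv, vS, vC]
  norm_num
  ring

/-- the companion `C = R¹[19/20](R¹[½])` recorded at `½·(360/361)` is TREE-OK at the floor `9/19`. [this work] -/
theorem witness3_companion_treeOK : (gluedSib 1 1 (19 / 20) (1 / 2) (1 / 2 * (360 / 361))).TreeOK (9 / 19) :=
  gluedSib_treeOK 1 1 le_rfl le_rfl (by norm_num) (by norm_num) (by norm_num) (by norm_num) (by norm_num) (by norm_num) (by norm_num)

/-- the law of `S = R¹[9/10](R¹⁶[½])` is tree-built (one nontrivial gate) at every floor `½·y`, `0 < y < 1` — its TREE floor is `½`; the witness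
records it at `10/19 > ½` instead. [this work] -/
theorem witness3_law_treeBuiltN {y : ℝ} (hy0 : 0 < y) (hy1 : y < 1) :
    TreeBuiltN (1 / 2 * y) 1 17 (gluedSib 1 16 (9 / 10) (1 / 2) (10 / 19)).ρ :=
  gluedSib_treeBuiltN 1 16 (by norm_num) (by norm_num) hy0 hy1

/-! ### The refutation on composite aff-OK lists -/

/-- **THE PURE FORM FAILS ON COMPOSITE AFF-OK LISTS** (the law-level clauses of `Sib.TreeOK` — law-OK, not a point mass — plus top-affordability of
the recorded sub-floor do NOT give light residual DEC).  Witness: `x = 9/19`, `L = [C, C, S]` as in the file header, `a = 19/20`, layer `5`: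
the residual's mass above `5` is `171/400 < 9/20 = min (a x) (1/2)`, contradicting `tail_ge_of_decAt`. [this work] -/
theorem not_lightResidDECOn_affOK_composite :
    ¬ LightResidDECOn (fun x L => (∀ s ∈ L, s.AffOK x ∧ ∀ K : ℕ, s.ρ ≠ fun h => if h = K then (1 : ℝ) else 0) ∧ 3 ≤ L.length) := by
  intro hlaw
  set S : Sib := gluedSib 1 16 (9 / 10) (1 / 2) (10 / 19) with hSdef
  set C : Sib := gluedSib 1 1 (19 / 20) (1 / 2) (1 / 2 * (360 / 361)) with hCdef
  set L : List Sib := [C, C, S] with hLdef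
  have hSlaw : S.LawOK := by
    obtain ⟨_, _, ρ0, ρM, ρ1, _⟩ :=
      (gluedSib_treeBuiltN 1 16 (by norm_num : (0 : ℝ) < 1 / 2) (by norm_num) (by norm_num : (0 : ℝ) < 1 / 2) (by norm_num)).lawFacts
    exact ⟨by rw [hSdef]; show (0 : ℝ) < 9 / 10; norm_num, by rw [hSdef]; show (9 / 10 : ℝ) < 1; norm_num, ρ0, ρM, ρ1⟩
  have hClaw : C.LawOK := by
    obtain ⟨_, _, ρ0, ρM, ρ1, _⟩ :=
      (gluedSib_treeBuiltN 1 1 (by norm_num : (0 : ℝ) < 1 / 2) (by norm_num) (by norm_num : (0 : ℝ) < 1 / 2) (by norm_num)).lawFacts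
    exact ⟨by rw [hCdef]; show (0 : ℝ) < 19 / 20; norm_num, by rw [hCdef]; show (19 / 20 : ℝ) < 1; norm_num, ρ0, ρM, ρ1⟩
  have hSmean : S.mean = 9 := by rw [hSdef, gluedSib_mean]; norm_num
  have hCmean : C.mean = 3 / 2 := by rw [hCdef, gluedSib_mean]; norm_num
  have hL : ∀ s ∈ L, s.LawOK := by
    intro s hs
    rw [hLdef] at hs
    simp only [List.mem_cons, List.mem_nil_iff, or_false] at hs
    rcases hs with h | h | h
    · rw [h]; exact hClaw
    · rw [h]; exact hClaw
    · rw [h]; exact hSlaw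
  -- the family hypothesis at floor 9/19
  have hfam : (∀ s ∈ L, s.AffOK (9 / 19) ∧ ∀ K : ℕ, s.ρ ≠ fun h => if h = K then (1 : ℝ) else 0) ∧ 3 ≤ L.length := by
    refine ⟨fun s hs => ?_, by rw [hLdef]; simp⟩
    rw [hLdef] at hs
    simp only [List.mem_cons, List.mem_nil_iff, or_false] at hs
    have hCaff : C.AffOK (9 / 19) ∧ ∀ K : ℕ, C.ρ ≠ fun h => if h = K then (1 : ℝ) else 0 := by
      refine ⟨⟨hClaw, by rw [hCdef]; show (0 : ℝ) < 1 / 2 * (360 / 361); norm_num,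
        by rw [hCdef]; show (9 / 19 : ℝ) ≤ 19 / 20 * (1 / 2 * (360 / 361)); norm_num, ?_⟩, fun K => ?_⟩
      · rw [hCmean, hCdef]; show (1 / 2 * (360 / 361) : ℝ) * ((1 + 1 : ℕ) : ℝ) ≤ 3 / 2; norm_num
      · rw [hCdef]; exact gluedSib_rho_ne_point 1 1 le_rfl le_rfl (by norm_num) (by norm_num) K
    rcases hs with h | h | h
    · rw [h]; exact hCaff
    · rw [h]; exact hCaff
    · rw [h]
      refine ⟨⟨hSlaw, by rw [hSdef]; show (0 : ℝ) < 10 / 19; norm_num,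
        by rw [hSdef]; show (9 / 19 : ℝ) ≤ 9 / 10 * (10 / 19); norm_num, ?_⟩, fun K => ?_⟩
      · rw [hSmean, hSdef]; show (10 / 19 : ℝ) * ((1 + 16 : ℕ) : ℝ) ≤ 9; norm_num
      · rw [hSdef]; exact gluedSib_rho_ne_point 1 16 le_rfl (by norm_num) (by norm_num) (by norm_num) K
  have htop : ftop L = 21 := by rw [hLdef, hSdef, hCdef]; rfl
  have hfmean : fmean L = 219 / 20 := by
    rw [hLdef]
    simp only [fmean]
    rw [hSmean, hCmean, hSdef, hCdef]
    show (0 : ℝ) + 9 / 10 * 9 + 19 / 20 * (3 / 2) + 19 / 20 * (3 / 2) = 219 / 20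
    norm_num
  -- the residual: weight, law facts, mean
  have hw1 : wco (19 / 20) L < 1 := by rw [hLdef]; exact wco_lt_one (by norm_num) C C [S] (by rw [← hLdef]; exact hL)
  obtain ⟨_, _, r1, rmn⟩ := resid_laws (a := 19 / 20) (by norm_num) (by norm_num) L hL le_rfl hw1
  rw [htop, hfmean] at rmn
  rw [htop] at r1
  -- mass of the forest laws below 6
  have hheadF : ∑ h ∈ Finset.range 6, flaw L h = 1 - 9 / 10 / 2 := by
    rw [hLdef, hCdef, hSdef]; exact head_flaw_glued_CCS _ _ _ _
  have hheadFa : ∑ h ∈ Finset.range 6, flaw (L.map (Sib.scale (19 / 20))) h = 1 - 19 / 20 * (9 / 10) / 2 := by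
    have e : L.map (Sib.scale (19 / 20)) = [gluedSib 1 1 (19 / 20 * (19 / 20)) (1 / 2) (1 / 2 * (360 / 361)),
        gluedSib 1 1 (19 / 20 * (19 / 20)) (1 / 2) (1 / 2 * (360 / 361)), gluedSib 1 16 (19 / 20 * (9 / 10)) (1 / 2) (10 / 19)] := by
      rw [hLdef, hCdef, hSdef]; rfl
    rw [e]; exact head_flaw_glued_CCS _ _ _ _
  have hheadG : ∑ h ∈ Finset.range 6, gate (flaw L) (19 / 20) h = 19 / 20 * (1 - 9 / 10 / 2) + (1 - 19 / 20) := by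
    rw [← hheadF, Finset.mul_sum]
    have e : ∀ h, gate (flaw L) (19 / 20) h = 19 / 20 * flaw L h + (1 - 19 / 20) * (if h = 0 then (1 : ℝ) else 0) := fun h => gate_apply _ _ h
    rw [Finset.sum_congr rfl fun h _ => e h, Finset.sum_add_distrib, ← Finset.mul_sum]
    congr 1
    simp [Finset.sum_ite_eq']
  have hhead : ∑ h ∈ Finset.range 6, resid (19 / 20) (wco (19 / 20) L) L h = 1 - 19 / 20 * (9 / 10) / 2 := by
    have hne : (1 - wco (19 / 20) L) ≠ 0 := by linarith
    show ∑ h ∈ Finset.range 6, (gate (flaw L) (19 / 20) h - wco (19 / 20) L * flaw (L.map (Sib.scale (19 / 20))) h) /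
        (1 - wco (19 / 20) L) = _
    rw [← Finset.sum_div, Finset.sum_sub_distrib, ← Finset.mul_sum, hheadG, hheadFa,
      show (19 / 20 * (1 - 9 / 10 / 2) + (1 - 19 / 20) : ℝ) - wco (19 / 20) L * (1 - 19 / 20 * (9 / 10) / 2) =
        (1 - 19 / 20 * (9 / 10) / 2) * (1 - wco (19 / 20) L) by ring,
      mul_div_assoc, div_self hne, mul_one]
  -- hence the mass above layer 5
  have htail : ∑ h ∈ Finset.Ico (5 + 1) (21 + 1), resid (19 / 20) (wco (19 / 20) L) L h = 171 / 400 := by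
    have hsplit := Finset.sum_Ico_consecutive (fun h => resid (19 / 20) (wco (19 / 20) L) L h) (show 0 ≤ 6 by norm_num)
      (show 6 ≤ 21 + 1 by norm_num)
    rw [← Finset.range_eq_Ico, ← Finset.range_eq_Ico, r1, hhead] at hsplit
    norm_num at hsplit ⊢
    linarith
  -- DEC at the dominant layer 5 would give the far row there
  have hd := hlaw (9 / 19) L (by norm_num) (by norm_num) hfam (19 / 20) (by norm_num) (by norm_num) 5 (by rw [htop]; norm_num)
  rw [htop] at hd
  have hrow := tail_ge_of_decAt (min (19 / 20 * (9 / 19)) (1 / 2)) 5 21 _ ((min_le_right _ _).trans (by norm_num)) hd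
    (by rw [rmn]; norm_num)
  rw [htail, min_eq_left (by norm_num)] at hrow
  norm_num at hrow

end LawDec

end Quant

end Summit.CriticalPhenomena.PercolationContinuityZ3.Theorems
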